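import Mathlib
import Summits.Ventures.PercRepro2.Defs
import Summits.Ventures.PercRepro2.Harris
import Summits.Ventures.PercRepro2.Independence
import Summits.Ventures.PercRepro2.CoinDefs
import Summits.Ventures.PercRepro2.CoinReverse
import Summits.Ventures.PercRepro2.CoinStarDefs
import Summits.Ventures.PercRepro2.CoinLsmCoreDefs
import Summits.Ventures.PercRepro2.CoinLsmCoreU
import Summits.Ventures.PercRepro2.CoinCoreGate
import Summits.Ventures.PercRepro2.CoinOrTailAlg
import Summits.Ventures.PercRepro2.CoinOrTailDefs
import Summits.Ventures.PercRepro2.CoinOrTailLsmDefs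
import Summits.Ventures.PercRepro2.CoinOrTailLsmSums
import Summits.Ventures.PercRepro2.CoinOrTailBlockAlg
import Summits.Ventures.PercRepro2.CoinOrTailBlockSums
import Summits.Ventures.PercRepro2.CoinOrTailMixLsm
import Summits.Ventures.PercRepro2.CoinLsmCoreSure
import Summits.Ventures.PercRepro2.CoinOrTailKDefs
import Summits.Ventures.PercRepro2.CoinOrTailKSums
import Summits.Ventures.PercRepro2.CoinOrTailKAlg
import Summits.Ventures.PercRepro2.CoinOrTailCovCore
import Summits.Ventures.PercRepro2.CoinOrTailKCore
import Summits.Ventures.PercRepro2.CoinK2HeadBlindVals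
import Summits.Ventures.PercRepro2.CoinPendantDefs
import Summits.Ventures.PercRepro2.CoinTreeCore
import Summits.Ventures.PercRepro2.CoinK2HeadAwareCore
import Summits.Ventures.PercRepro2.CoinK2HeadAwareCoinsAlg

/-!
# Row 2′DARC at an OR-tail with two incomparable uncovered entries of ARBITRARY coin
probabilities, any head (blind cell PercRepro2, night-2 g13; proofs/NIGHT2-DARC.md §48.7)

`orTailK2_functional_nonneg_coins`: the functional of the original system equals that of the
extended sure-coin system (`ext_sum_rValK`, `ext_sum_gValK` of `CoinK2HeadAwareCoinsAlg`), whose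
data are log-supermodular (`coinFactor_mul_le`), so `orTailK2_functional_nonneg` applies.
`darc_of_orTailK2_coins`: the DARC theorem — `OrTailK`, `ent = {r₁, r₂}` with ANY coin
probabilities, the cluster law of `U` log-supermodular, any two markers, any head, two spare
vertices outside `U ∪ {a, w}`.
-/

namespace Summit.Ventures.PercRepro2.Coin

open Classical

section CoinsFunctional

variable {V : Type*} {E : Type*} [Fintype V] [DecidableEq V] {R : Type*} [Field R] [LinearOrder R]
  [IsStrictOrderedRing R]

/-- **THE HEAD-AWARE TWO-ENTRY OR-TAIL FUNCTIONAL IS NONNEGATIVE FOR ARBITRARY ENTRY COINS**: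
`ent = {r₁, r₂} ⊆ U` with ANY coin probabilities, two spare vertices `r₁', r₂'` outside
`U ∪ {a, w}`, the cluster law `ν` log-supermodular, the head `A` nonnegative, decreasing and
log-supermodular; any two markers in `U`. -/
theorem orTailK2_functional_nonneg_coins (U : Finset V) (ν A : Finset V → R) (pr : E → R)
    (ent : Finset V) (c : V → E) (r₁ r₂ r₁' r₂' m₁ m₂ a w : V)
    (hp0 : ∀ e, 0 ≤ pr e) (hp1 : ∀ e, pr e ≤ 1)
    (hr₁ : r₁ ∈ ent) (hr₂ : r₂ ∈ ent) (hent : ∀ r ∈ ent, r = r₁ ∨ r = r₂) (hr₁₂ : r₁ ≠ r₂)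
    (hr₁U : r₁ ∈ U) (hr₂U : r₂ ∈ U) (hm₁ : m₁ ∈ U) (hm₂ : m₂ ∈ U)
    (hr₁' : r₁' ∉ U) (hr₂' : r₂' ∉ U) (hr' : r₁' ≠ r₂') (hr₁'a : r₁' ≠ a) (hr₁'w : r₁' ≠ w)
    (hr₂'a : r₂' ≠ a) (hr₂'w : r₂' ≠ w)
    (hν0 : ∀ W, 0 ≤ ν W) (hν : ∀ s ⊆ U, ∀ t ⊆ U, ν s * ν t ≤ ν (s ∩ t) * ν (s ∪ t))
    (hA0 : ∀ W, 0 ≤ A W) (hA : ∀ s t : Finset V, A s * A t ≤ A (s ∩ t) * A (s ∪ t))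
    (hmono : ∀ s t : Finset V, s ⊆ t → A t ≤ A s) :
    0 ≤ (∑ W ∈ U.powerset, ν W * rValK A pr ent c a W) ^ 2 *
          (∑ W ∈ U.powerset, ν W * gValK A pr ent c a w W *
            ((if m₁ ∈ W then (1 : R) else 0) * (if m₂ ∈ W then (1 : R) else 0)))
        - (∑ W ∈ U.powerset, ν W * rValK A pr ent c a W) *
          (∑ W ∈ U.powerset, ν W * rValK A pr ent c a W * (if m₁ ∈ W then (1 : R) else 0)) *
          (∑ W ∈ U.powerset, ν W * gValK A pr ent c a w W * (if m₂ ∈ W then (1 : R) else 0))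
        - (∑ W ∈ U.powerset, ν W * rValK A pr ent c a W) *
          (∑ W ∈ U.powerset, ν W * rValK A pr ent c a W * (if m₂ ∈ W then (1 : R) else 0)) *
          (∑ W ∈ U.powerset, ν W * gValK A pr ent c a w W * (if m₁ ∈ W then (1 : R) else 0))
        + (∑ W ∈ U.powerset, ν W * rValK A pr ent c a W * (if m₁ ∈ W then (1 : R) else 0)) *
          (∑ W ∈ U.powerset, ν W * rValK A pr ent c a W * (if m₂ ∈ W then (1 : R) else 0)) *
          (∑ W ∈ U.powerset, ν W * gValK A pr ent c a w W) := by
  have hentEq : ent = {r₁, r₂} := by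
    ext r
    simp only [Finset.mem_insert, Finset.mem_singleton]
    exact ⟨fun h => hent r h, fun h => by rcases h with rfl | rfl <;> assumption⟩
  subst hentEq
  -- the extended system
  set ν' : Finset V → R := fun W' => ν (W' ∩ U) *
    ((if r₁' ∈ W' then (if r₁ ∈ W' then pr (c r₁) else 0)
      else (if r₁ ∈ W' then 1 - pr (c r₁) else 1)) *
    (if r₂' ∈ W' then (if r₂ ∈ W' then pr (c r₂) else 0)
      else (if r₂ ∈ W' then 1 - pr (c r₂) else 1))) with hν'def
  set A' : Finset V → R := fun Y => A (Y ∩ (U ∪ {a, w})) with hA'def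
  have hν'0 : ∀ W, 0 ≤ ν' W := fun W => mul_nonneg (hν0 _)
    (mul_nonneg (coinFactor_nonneg r₁ r₁' (hp0 (c r₁)) (hp1 (c r₁)) W)
      (coinFactor_nonneg r₂ r₂' (hp0 (c r₂)) (hp1 (c r₂)) W))
  have hν' : ∀ s ⊆ insert r₂' (insert r₁' U), ∀ t ⊆ insert r₂' (insert r₁' U),
      ν' s * ν' t ≤ ν' (s ∩ t) * ν' (s ∪ t) := by
    intro s _ t _
    simp only [hν'def]
    have e1 : (s ∩ t) ∩ U = (s ∩ U) ∩ (t ∩ U) := by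
      ext x; simp only [Finset.mem_inter]; tauto
    have e2 : (s ∪ t) ∩ U = (s ∩ U) ∪ (t ∩ U) := Finset.union_inter_distrib_right _ _ _
    have hh := hν (s ∩ U) Finset.inter_subset_right (t ∩ U) Finset.inter_subset_right
    rw [← e1, ← e2] at hh
    have c1 := coinFactor_mul_le r₁ r₁' (hp0 (c r₁)) s t
    have c2 := coinFactor_mul_le r₂ r₂' (hp0 (c r₂)) s t
    have n1 := coinFactor_nonneg r₁ r₁' (hp0 (c r₁)) (hp1 (c r₁))
    have n2 := coinFactor_nonneg r₂ r₂' (hp0 (c r₂)) (hp1 (c r₂))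
    calc ν (s ∩ U) * ((if r₁' ∈ s then (if r₁ ∈ s then pr (c r₁) else 0)
            else (if r₁ ∈ s then 1 - pr (c r₁) else 1)) *
          (if r₂' ∈ s then (if r₂ ∈ s then pr (c r₂) else 0)
            else (if r₂ ∈ s then 1 - pr (c r₂) else 1))) *
        (ν (t ∩ U) * ((if r₁' ∈ t then (if r₁ ∈ t then pr (c r₁) else 0)
            else (if r₁ ∈ t then 1 - pr (c r₁) else 1)) *
          (if r₂' ∈ t then (if r₂ ∈ t then pr (c r₂) else 0)
            else (if r₂ ∈ t then 1 - pr (c r₂) else 1))))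
        = (ν (s ∩ U) * ν (t ∩ U)) *
          (((if r₁' ∈ s then (if r₁ ∈ s then pr (c r₁) else 0)
            else (if r₁ ∈ s then 1 - pr (c r₁) else 1)) *
           (if r₁' ∈ t then (if r₁ ∈ t then pr (c r₁) else 0)
            else (if r₁ ∈ t then 1 - pr (c r₁) else 1))) *
          ((if r₂' ∈ s then (if r₂ ∈ s then pr (c r₂) else 0)
            else (if r₂ ∈ s then 1 - pr (c r₂) else 1)) *
           (if r₂' ∈ t then (if r₂ ∈ t then pr (c r₂) else 0)
            else (if r₂ ∈ t then 1 - pr (c r₂) else 1)))) := by ring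
      _ ≤ (ν (s ∩ t ∩ U) * ν ((s ∪ t) ∩ U)) *
          (((if r₁' ∈ s ∩ t then (if r₁ ∈ s ∩ t then pr (c r₁) else 0)
            else (if r₁ ∈ s ∩ t then 1 - pr (c r₁) else 1)) *
           (if r₁' ∈ s ∪ t then (if r₁ ∈ s ∪ t then pr (c r₁) else 0)
            else (if r₁ ∈ s ∪ t then 1 - pr (c r₁) else 1))) *
          ((if r₂' ∈ s ∩ t then (if r₂ ∈ s ∩ t then pr (c r₂) else 0)
            else (if r₂ ∈ s ∩ t then 1 - pr (c r₂) else 1)) *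
           (if r₂' ∈ s ∪ t then (if r₂ ∈ s ∪ t then pr (c r₂) else 0)
            else (if r₂ ∈ s ∪ t then 1 - pr (c r₂) else 1)))) := by
          apply mul_le_mul hh (mul_le_mul c1 c2 (mul_nonneg (n2 _) (n2 _)) (mul_nonneg (n1 _) (n1 _)))
          · exact mul_nonneg (mul_nonneg (n1 _) (n1 _)) (mul_nonneg (n2 _) (n2 _))
          · exact mul_nonneg (hν0 _) (hν0 _)
      _ = _ := by ring
  have hA'0 : ∀ W, 0 ≤ A' W := fun W => hA0 _
  have hA' : ∀ s t : Finset V, A' s * A' t ≤ A' (s ∩ t) * A' (s ∪ t) := by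
    intro s t
    simp only [hA'def]
    have e1 : (s ∩ t) ∩ (U ∪ {a, w}) = (s ∩ (U ∪ {a, w})) ∩ (t ∩ (U ∪ {a, w})) := by
      ext x; simp only [Finset.mem_inter]; tauto
    have e2 : (s ∪ t) ∩ (U ∪ {a, w}) = (s ∩ (U ∪ {a, w})) ∪ (t ∩ (U ∪ {a, w})) :=
      Finset.union_inter_distrib_right _ _ _
    rw [e1, e2]
    exact hA _ _
  have hmono' : ∀ s t : Finset V, s ⊆ t → A' t ≤ A' s := fun s t hst =>
    hmono _ _ (Finset.inter_subset_inter hst le_rfl)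
  have hent' : ∀ r ∈ ({r₁', r₂'} : Finset V), r = r₁' ∨ r = r₂' := by
    intro r hr; simpa using hr
  have key := orTailK2_functional_nonneg (insert r₂' (insert r₁' U)) ν' A' (fun _ : E => (1 : R))
    {r₁', r₂'} c r₁' r₂' m₁ m₂ a w (fun _ => zero_le_one) (fun _ => le_rfl) (fun _ _ => rfl)
    (Finset.mem_insert_self _ _) (by simp) hent' hν'0 hν' hA'0 hA' hmono'
  simp only [hν'def, hA'def] at key
  -- summing out the virtual vertices
  have hm₁' : m₁ ≠ r₁' := fun h => hr₁' (h ▸ hm₁)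
  have hm₁'' : m₁ ≠ r₂' := fun h => hr₂' (h ▸ hm₁)
  have hm₂' : m₂ ≠ r₁' := fun h => hr₁' (h ▸ hm₂)
  have hm₂'' : m₂ ≠ r₂' := fun h => hr₂' (h ▸ hm₂)
  have J1 : ∀ W ⊆ U, (fun W : Finset V => if m₁ ∈ W then (1 : R) else 0) (insert r₁' W) =
      (fun W : Finset V => if m₁ ∈ W then (1 : R) else 0) W ∧
      (fun W : Finset V => if m₁ ∈ W then (1 : R) else 0) (insert r₂' W) =
      (fun W : Finset V => if m₁ ∈ W then (1 : R) else 0) W ∧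
      (fun W : Finset V => if m₁ ∈ W then (1 : R) else 0) (insert r₂' (insert r₁' W)) =
      (fun W : Finset V => if m₁ ∈ W then (1 : R) else 0) W := by
    intro W _; simp [Finset.mem_insert, hm₁', hm₁'']
  have J2 : ∀ W ⊆ U, (fun W : Finset V => if m₂ ∈ W then (1 : R) else 0) (insert r₁' W) =
      (fun W : Finset V => if m₂ ∈ W then (1 : R) else 0) W ∧
      (fun W : Finset V => if m₂ ∈ W then (1 : R) else 0) (insert r₂' W) =
      (fun W : Finset V => if m₂ ∈ W then (1 : R) else 0) W ∧
      (fun W : Finset V => if m₂ ∈ W then (1 : R) else 0) (insert r₂' (insert r₁' W)) =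
      (fun W : Finset V => if m₂ ∈ W then (1 : R) else 0) W := by
    intro W _; simp [Finset.mem_insert, hm₂', hm₂'']
  have J12 : ∀ W ⊆ U,
      (fun W : Finset V => (if m₁ ∈ W then (1 : R) else 0) * (if m₂ ∈ W then (1 : R) else 0))
        (insert r₁' W) =
      (fun W : Finset V => (if m₁ ∈ W then (1 : R) else 0) * (if m₂ ∈ W then (1 : R) else 0)) W ∧
      (fun W : Finset V => (if m₁ ∈ W then (1 : R) else 0) * (if m₂ ∈ W then (1 : R) else 0))
        (insert r₂' W) =
      (fun W : Finset V => (if m₁ ∈ W then (1 : R) else 0) * (if m₂ ∈ W then (1 : R) else 0)) W ∧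
      (fun W : Finset V => (if m₁ ∈ W then (1 : R) else 0) * (if m₂ ∈ W then (1 : R) else 0))
        (insert r₂' (insert r₁' W)) =
      (fun W : Finset V => (if m₁ ∈ W then (1 : R) else 0) * (if m₂ ∈ W then (1 : R) else 0)) W := by
    intro W _; simp [Finset.mem_insert, hm₁', hm₁'', hm₂', hm₂'']
  have J0 : ∀ W ⊆ U, (fun _ : Finset V => (1 : R)) (insert r₁' W) = (fun _ : Finset V => (1 : R)) W ∧
      (fun _ : Finset V => (1 : R)) (insert r₂' W) = (fun _ : Finset V => (1 : R)) W ∧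
      (fun _ : Finset V => (1 : R)) (insert r₂' (insert r₁' W)) = (fun _ : Finset V => (1 : R)) W :=
    fun _ _ => ⟨rfl, rfl, rfl⟩
  have eR0 := ext_sum_rValK U ν A pr c r₁ r₂ r₁' r₂' a w hr₁U hr₂U hr₁₂ hr₁' hr₂' hr' hr₁'a hr₁'w
    hr₂'a hr₂'w (fun _ => (1 : R)) J0
  have eR1 := ext_sum_rValK U ν A pr c r₁ r₂ r₁' r₂' a w hr₁U hr₂U hr₁₂ hr₁' hr₂' hr' hr₁'a hr₁'w
    hr₂'a hr₂'w (fun W => if m₁ ∈ W then (1 : R) else 0) J1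
  have eR2 := ext_sum_rValK U ν A pr c r₁ r₂ r₁' r₂' a w hr₁U hr₂U hr₁₂ hr₁' hr₂' hr' hr₁'a hr₁'w
    hr₂'a hr₂'w (fun W => if m₂ ∈ W then (1 : R) else 0) J2
  have eG0 := ext_sum_gValK U ν A pr c r₁ r₂ r₁' r₂' a w hr₁U hr₂U hr₁₂ hr₁' hr₂' hr' hr₁'a hr₁'w
    hr₂'a hr₂'w (fun _ => (1 : R)) J0
  have eG1 := ext_sum_gValK U ν A pr c r₁ r₂ r₁' r₂' a w hr₁U hr₂U hr₁₂ hr₁' hr₂' hr' hr₁'a hr₁'w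
    hr₂'a hr₂'w (fun W => if m₁ ∈ W then (1 : R) else 0) J1
  have eG2 := ext_sum_gValK U ν A pr c r₁ r₂ r₁' r₂' a w hr₁U hr₂U hr₁₂ hr₁' hr₂' hr' hr₁'a hr₁'w
    hr₂'a hr₂'w (fun W => if m₂ ∈ W then (1 : R) else 0) J2
  have eG12 := ext_sum_gValK U ν A pr c r₁ r₂ r₁' r₂' a w hr₁U hr₂U hr₁₂ hr₁' hr₂' hr' hr₁'a hr₁'w
    hr₂'a hr₂'w (fun W => (if m₁ ∈ W then (1 : R) else 0) * (if m₂ ∈ W then (1 : R) else 0)) J12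
  simp only [mul_one] at eR0 eG0
  rw [eR0, eR1, eR2, eG0, eG1, eG2, eG12] at key
  exact key

end CoinsFunctional

section CoinsMain

variable {V : Type*} {E : Type*} [Fintype V] [DecidableEq V] [Fintype E] [DecidableEq E]
  {R : Type*} [Field R] [LinearOrder R] [IsStrictOrderedRing R]
  {arcs : E → Finset (V × V)} {s : V} {U : Finset V} {ent : Finset V} {c : V → E} {a w : V}

/-- **THEOREM (row 2′DARC at an OR-tail with two incomparable uncovered entries of ARBITRARY coin
probabilities — any head).**  `OrTailK arcs s U ent c a` with `ent = {r₁, r₂}` (`hr₁, hr₂, hent`,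
`r₁ ≠ r₂`), ANY coin probabilities, `SameEnds`, the cluster law of `U` log-supermodular (`hν`),
ANY two markers `m₁, m₂ ∈ U`, two spare vertices `r₁', r₂' ∉ U ∪ {a, w}`, `t, w ∉ U ∪ {a, s}` ⟹
`Φ_D({s ↛ t in D + (a → w)}) ≥ 0` for the markers `m₁, m₂` at every head, every probability
vector. -/
theorem darc_of_orTailK2_coins (pr : E → R) (hp : IsProbVec pr) (hS : SameEnds arcs)
    (h : OrTailK arcs s U ent c a) {r₁ r₂ r₁' r₂' m₁ m₂ : V} (hm₁ : m₁ ∈ U) (hm₂ : m₂ ∈ U)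
    (hr₁ : r₁ ∈ ent) (hr₂ : r₂ ∈ ent) (hent : ∀ r ∈ ent, r = r₁ ∨ r = r₂) (hr₁₂ : r₁ ≠ r₂)
    (hr₁' : r₁' ∉ U) (hr₂' : r₂' ∉ U) (hr' : r₁' ≠ r₂') (hr₁'a : r₁' ≠ a) (hr₁'w : r₁' ≠ w)
    (hr₂'a : r₂' ≠ a) (hr₂'w : r₂' ≠ w)
    (hν : ∀ W W', W ⊆ U → W' ⊆ U →
      prob pr (coreLevel arcs s U W) * prob pr (coreLevel arcs s U W') ≤
        prob pr (coreLevel arcs s U (W ∩ W')) * prob pr (coreLevel arcs s U (W ∪ W')))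
    {t : V} (htC : t ∉ insert a U) (hts : t ≠ s) (hws : w ≠ s) (hwC : w ∉ insert a U) :
    DARC pr arcs s {t} m₁ m₂ a w := by
  have hC := h.closedInCoreU
  have hm₁a : m₁ ≠ a := fun e => h.a_notin (e ▸ hm₁)
  have hm₂a : m₂ ≠ a := fun e => h.a_notin (e ▸ hm₂)
  have hm₁C : m₁ ∈ insert a U := Finset.mem_insert_of_mem hm₁
  have hm₂C : m₂ ∈ insert a U := Finset.mem_insert_of_mem hm₂
  have haC : a ∈ insert a U := Finset.mem_insert_self _ _
  unfold DARC
  rw [hC.phiC_gate_eq pr hS htC hts hm₁C hm₂C haC hws hwC]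
  have hm1 : ∀ W : Finset V, (fun _ : Finset V => (1 : R)) (insert a W) = (fun _ => (1 : R)) W :=
    fun _ => rfl
  have hmp : ∀ W : Finset V, (fun W : Finset V => if m₁ ∈ W then (1 : R) else 0) (insert a W) =
      (fun W : Finset V => if m₁ ∈ W then (1 : R) else 0) W := by
    intro W; simp only [Finset.mem_insert, hm₁a, false_or]
  have hmq : ∀ W : Finset V, (fun W : Finset V => if m₂ ∈ W then (1 : R) else 0) (insert a W) =
      (fun W : Finset V => if m₂ ∈ W then (1 : R) else 0) W := by
    intro W; simp only [Finset.mem_insert, hm₂a, false_or]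
  have hmpq : ∀ W : Finset V,
      (fun W : Finset V => (if m₁ ∈ W then (1 : R) else 0) * (if m₂ ∈ W then (1 : R) else 0))
        (insert a W) =
      (fun W : Finset V => (if m₁ ∈ W then (1 : R) else 0) * (if m₂ ∈ W then (1 : R) else 0)) W := by
    intro W; simp only [Finset.mem_insert, hm₁a, hm₂a, false_or]
  have eΛ := h.sum_R_eq pr t (fun _ => (1 : R)) hm1
  have eFa := h.sum_R_eq pr t (fun W => if m₁ ∈ W then (1 : R) else 0) hmp
  have eFb := h.sum_R_eq pr t (fun W => if m₂ ∈ W then (1 : R) else 0) hmq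
  have eM := h.sum_G_eq (w := w) pr t (fun _ => (1 : R)) hm1
  have eX := h.sum_G_eq (w := w) pr t (fun W => if m₁ ∈ W then (1 : R) else 0) hmp
  have eY := h.sum_G_eq (w := w) pr t (fun W => if m₂ ∈ W then (1 : R) else 0) hmq
  have eXY := h.sum_G_eq (w := w) pr t
    (fun W => (if m₁ ∈ W then (1 : R) else 0) * (if m₂ ∈ W then (1 : R) else 0)) hmpq
  simp only [mul_one] at eΛ eM
  rw [eΛ, eFa, eFb, eM, eX, eY, eXY]
  obtain ⟨hA0, hAmono, hAlsm⟩ := OrTailU.head_props (U := U) (a := a) pr hp hS t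
  exact orTailK2_functional_nonneg_coins U (fun W => prob pr (coreLevel arcs s U W))
    (fun X => prob pr (coreAvoidEvent arcs s t (insert a U) X)) pr ent c r₁ r₂ r₁' r₂' m₁ m₂ a w
    hp.nonneg hp.le_one hr₁ hr₂ hent hr₁₂ (h.ent_sub hr₁) (h.ent_sub hr₂) hm₁ hm₂ hr₁' hr₂' hr'
    hr₁'a hr₁'w hr₂'a hr₂'w (fun W => prob_nonneg hp _) (fun s' hs' t' ht' => hν s' t' hs' ht')
    hA0 hAlsm hAmono

/-- **COROLLARY (out-tree core, arbitrary entry coins, any head).** -/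
theorem darc_of_orTailTreeK2_coins (pr : E → R) (hp : IsProbVec pr) (hS : SameEnds arcs)
    (h : OrTailK arcs s U ent c a) {c' : V → E} {par : V → V} {rk : V → ℕ}
    (hT : TreeCore arcs s U c' par rk) {r₁ r₂ r₁' r₂' m₁ m₂ : V} (hm₁ : m₁ ∈ U) (hm₂ : m₂ ∈ U)
    (hr₁ : r₁ ∈ ent) (hr₂ : r₂ ∈ ent) (hent : ∀ r ∈ ent, r = r₁ ∨ r = r₂) (hr₁₂ : r₁ ≠ r₂)
    (hr₁' : r₁' ∉ U) (hr₂' : r₂' ∉ U) (hr' : r₁' ≠ r₂') (hr₁'a : r₁' ≠ a) (hr₁'w : r₁' ≠ w)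
    (hr₂'a : r₂' ≠ a) (hr₂'w : r₂' ≠ w)
    {t : V} (htC : t ∉ insert a U) (hts : t ≠ s) (hws : w ≠ s) (hwC : w ∉ insert a U) :
    DARC pr arcs s {t} m₁ m₂ a w :=
  darc_of_orTailK2_coins pr hp hS h hm₁ hm₂ hr₁ hr₂ hent hr₁₂ hr₁' hr₂' hr' hr₁'a hr₁'w hr₂'a hr₂'w
    (hT.coreLevel_lsm pr hp) htC hts hws hwC

end CoinsMain

end Summit.Ventures.PercRepro2.Coin
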